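import Mathlib.Analysis.SpecialFunctions.Pow.Real
import Mathlib.Topology.MetricSpace.Basic
import HarnessLib

/-!
# NE7SliceInductionRates — THE REAL-NUMBER BOOKKEEPING OF THE REP♭ SUP INDUCTION: a uniform threshold `θ₀(constants) > 0` below which every
# smallness line of the nonlinear step holds at EVERY level `Λ = L^j ≤ M` and the step's output rate `9ρ₁ + 8η∕Λ` is again `≤ C′θ∕Λ`
# (`NE7SliceInductionRates`)

Cell `pub-balaban`, lineage `t4-ne7-p1` (CRUX PROVER NE7 #1 = OWNER of row NE7), gen 73; the arithmetic of the induction `L(j−1) ⇒ L(j)` of the road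
`t4/b2b-balaban-t4-ne7-p1-g73/REP-FLAT-ROAD-v2.md` §2, separated from the lattice files (`NE7SliceStepNonlinear` = the step, `NE7AxialGaugeData` = step 0) so
that the END (`NE7SliceInduction`) is pure composition.  CURRENCY: `θ = M²ε` (`= δ`, the plaquette radius in block units), `Λ = L^j` the running block side,
`1 ≤ Λ ≤ M`; the running link bound is `a = C′Lθ∕Λ` (`= C′θ∕L^{j−1}`); the intrinsic level data are `β′ ≤ c_b θ`, `η ≤ c_η θ`; the step's rates are
`ρ = K₁Λ(ε + 32s²) + K₂(2β′ + C₂(Λs)²)∕Λ`, `t = K₃(Λs + (2β′ + C₂(Λs)²) + Λ²(ε + 32s²))`, `s = 2a`, `ρ₁ = 2ρ + 8(t + ρ + 2a)(ρ + 2a)`, and the claim is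
`9ρ₁ + 8η∕Λ ≤ C′θ∕Λ` with **`C′ := 18K₁ + 36K₂c_b + 8c_η + c_a + 1`** once `θ ≤ θ₀`; `θ₀` depends on the constants and on `L` only — NOT on `Λ`, `M`
(i.e. not on the level, `k` or `N`).  METHOD: every smallness line is implied by an inequality `F(θ) ≤ c` with `F` an explicit polynomial vanishing at
`0`; `θ₀` is read off the continuity of finitely many such `F` at `0` (no explicit threshold is computed).

HONEST FRAMING (page 1): [folklore] real arithmetic; 0 def, 0 sorry; nothing of Bałaban's; REP♭ NOT proved here; (APE) NOT proved; NE7 NOT PRINTED ∕ NOT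
PROVED; spine PROVED 0∕9; finite T⁴ rung (B)+1 — NOT infinite volume, NOT mass gap, NOT BetaPertH, NOT Clay.  PLACEMENT: our lemma, under
`Summits/QuantumFields/BalabanUV/`.
Continuum YM on T⁴ ⇐ BetaPertH ∧ nine spine estimates (0/9 proved); BetaPertH ⇐ (D1) ∧ (D4) ∧ CAP+tail; G-an2-4 gates asym, D1 and NE2/3/4.
-/

set_option autoImplicit false

open Filter Topology

namespace Summit.QuantumFields.BalabanUV.T4Continuum.NE7SliceInductionRates

/-! ## §1 A threshold from continuity at `0` -/

/-- If `F` is continuous at `0` with `F 0 < c`, then `F θ ≤ c` for all `θ` in some `[0, θ₀]`, `θ₀ > 0`. [folklore] -/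
theorem exists_threshold {F : ℝ → ℝ} (hF : ContinuousAt F 0) {c : ℝ} (hc : F 0 < c) :
    ∃ θ₀ : ℝ, 0 < θ₀ ∧ ∀ θ : ℝ, 0 ≤ θ → θ ≤ θ₀ → F θ ≤ c := by
  have hev : ∀ᶠ θ in 𝓝 (0 : ℝ), F θ < c := hF.eventually_lt_const hc |>.mono fun _ h => h
  obtain ⟨r, hr, h⟩ := Metric.eventually_nhds_iff.mp hev
  refine ⟨r / 2, by positivity, fun θ hθ0 hθr => (h ?_).le⟩
  rw [Real.dist_eq, sub_zero, abs_of_nonneg hθ0]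
  linarith

/-- Two thresholds combine. [folklore] -/
theorem threshold_and {P Q : ℝ → Prop} (hP : ∃ θ₀ : ℝ, 0 < θ₀ ∧ ∀ θ : ℝ, 0 ≤ θ → θ ≤ θ₀ → P θ)
    (hQ : ∃ θ₀ : ℝ, 0 < θ₀ ∧ ∀ θ : ℝ, 0 ≤ θ → θ ≤ θ₀ → Q θ) :
    ∃ θ₀ : ℝ, 0 < θ₀ ∧ ∀ θ : ℝ, 0 ≤ θ → θ ≤ θ₀ → P θ ∧ Q θ := by
  obtain ⟨a, ha, hPa⟩ := hP
  obtain ⟨b, hb, hQb⟩ := hQ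
  exact ⟨min a b, lt_min ha hb, fun θ h0 h1 => ⟨hPa θ h0 (h1.trans (min_le_left _ _)), hQb θ h0 (h1.trans (min_le_right _ _))⟩⟩

/-! ## §2 The rates of one step -/

/-- **THE STEP ARITHMETIC**: with `C′ = 18K₁ + 36K₂c_b + 8c_η + c_a + 1` there is `θ₀ > 0` (constants and `L` only) such that for `0 ≤ θ ≤ θ₀`, all `1 ≤ Λ ≤ M`,
all level data `β′ ≤ c_bθ`, `η ≤ c_ηθ`: the six smallness lines of `NE7SliceStepNonlinear.sliceStep_nonlinear` hold for `a = C′Lθ∕Λ`, `ε = θ∕M²`, and its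
output obeys `9ρ₁ + 8η∕Λ ≤ C′θ∕Λ`; moreover `c_aθ ≤ C′θ` (the base) and two extra class lines `A₁θ ≤ 1∕2`, `A₂θ ≤ 1` hold. [folklore] -/
theorem step_rates {K₁ K₂ K₃ C₂ cb cη ca D r L A₁ A₂ : ℝ} (hK₁ : 0 ≤ K₁) (hK₂ : 0 ≤ K₂) (hK₃ : 0 ≤ K₃) (hC₂ : 0 ≤ C₂)
    (hcb : 0 ≤ cb) (hcη : 0 ≤ cη) (hca : 0 ≤ ca) (hD : 0 ≤ D) (hr : 0 < r) (hL : 1 ≤ L) :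
    ∃ θ₀ : ℝ, 0 < θ₀ ∧ ∀ θ : ℝ, 0 ≤ θ → θ ≤ θ₀ →
      A₁ * θ ≤ 1 / 2 ∧ A₂ * θ ≤ 1 ∧ cb * θ ≤ 1 / 4 ∧
      ∀ (Λ M b h : ℝ), 1 ≤ Λ → Λ ≤ M → 0 ≤ b → b ≤ cb * θ → 0 ≤ h → h ≤ cη * θ →
      ∀ (a ρ t : ℝ), a = (18 * K₁ + 36 * K₂ * cb + 8 * cη + ca + 1) * L * θ / Λ →
        ρ = K₁ * Λ * (θ / M ^ 2 + 32 * (2 * a) ^ 2) + K₂ * (2 * b + C₂ * (Λ * (2 * a)) ^ 2) / Λ →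
        t = K₃ * (Λ * (2 * a) + (2 * b + C₂ * (Λ * (2 * a)) ^ 2) + Λ ^ 2 * (θ / M ^ 2 + 32 * (2 * a) ^ 2)) →
        a ≤ 1 / 128 ∧ 4 * (3 + 12 * D) ^ 2 * Λ * (2 * a) ≤ r ^ 2 ∧ ρ + 2 * a ≤ 1 / 4 ∧ t ≤ 1 / 4 ∧
        300 * D * (Λ * (2 * ρ + 8 * (t + (ρ + 2 * a)) * (ρ + 2 * a)) + h) ≤ 1 ∧
        9 * (2 * ρ + 8 * (t + (ρ + 2 * a)) * (ρ + 2 * a)) + 8 * h / Λ ≤ (18 * K₁ + 36 * K₂ * cb + 8 * cη + ca + 1) * θ / Λ := by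
  set C' : ℝ := 18 * K₁ + 36 * K₂ * cb + 8 * cη + ca + 1 with hC'
  have hC'1 : 1 ≤ C' := by
    rw [hC']
    have : 0 ≤ 36 * K₂ * cb := by positivity
    linarith
  have hC'0 : 0 ≤ C' := by linarith
  -- the polynomial majorants (functions of `θ` alone)
  set R : ℝ → ℝ := fun θ => K₁ + 2 * K₂ * cb + (128 * K₁ + 4 * K₂ * C₂) * C' ^ 2 * L ^ 2 * θ with hRdef
  set X : ℝ → ℝ := fun θ => R θ + 2 * C' * L with hXdef
  set T : ℝ → ℝ := fun θ => K₃ * (2 * C' * L + 2 * cb + 1 + (4 * C₂ + 128) * C' ^ 2 * L ^ 2 * θ) with hTdef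
  set Y : ℝ → ℝ := fun θ => T θ + X θ with hYdef
  clear_value Y T X R
  have hR0 : ∀ θ, 0 ≤ θ → 0 ≤ R θ := fun θ hθ => by simp only [hRdef]; positivity
  have hX0 : ∀ θ, 0 ≤ θ → 0 ≤ X θ := fun θ hθ => by simp only [hXdef]; have := hR0 θ hθ; positivity
  have hT0 : ∀ θ, 0 ≤ θ → 0 ≤ T θ := fun θ hθ => by simp only [hTdef]; positivity
  have hY0 : ∀ θ, 0 ≤ θ → 0 ≤ Y θ := fun θ hθ => by simp only [hYdef]; have := hT0 θ hθ; have := hX0 θ hθ; positivity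
  have cR : Continuous R := by simp only [hRdef]; fun_prop
  have cX : Continuous X := by simp only [hXdef]; fun_prop
  have cT : Continuous T := by simp only [hTdef]; fun_prop
  have cY : Continuous Y := by simp only [hYdef]; fun_prop
  -- the ten thresholds
  have t1 : ∃ θ₀ : ℝ, 0 < θ₀ ∧ ∀ θ : ℝ, 0 ≤ θ → θ ≤ θ₀ → A₁ * θ ≤ 1 / 2 :=
    exists_threshold (F := fun θ => A₁ * θ) (by fun_prop) (by norm_num)
  have t2 : ∃ θ₀ : ℝ, 0 < θ₀ ∧ ∀ θ : ℝ, 0 ≤ θ → θ ≤ θ₀ → A₂ * θ ≤ 1 :=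
    exists_threshold (F := fun θ => A₂ * θ) (by fun_prop) (by norm_num)
  have t3 : ∃ θ₀ : ℝ, 0 < θ₀ ∧ ∀ θ : ℝ, 0 ≤ θ → θ ≤ θ₀ → cb * θ ≤ 1 / 4 :=
    exists_threshold (F := fun θ => cb * θ) (by fun_prop) (by norm_num)
  have t4 : ∃ θ₀ : ℝ, 0 < θ₀ ∧ ∀ θ : ℝ, 0 ≤ θ → θ ≤ θ₀ → C' * L * θ ≤ 1 / 128 :=
    exists_threshold (F := fun θ => C' * L * θ) (by fun_prop) (by norm_num)
  have t5 : ∃ θ₀ : ℝ, 0 < θ₀ ∧ ∀ θ : ℝ, 0 ≤ θ → θ ≤ θ₀ → 8 * (3 + 12 * D) ^ 2 * C' * L * θ ≤ r ^ 2 :=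
    exists_threshold (F := fun θ => 8 * (3 + 12 * D) ^ 2 * C' * L * θ) (by fun_prop) (by norm_num; positivity)
  have t6 : ∃ θ₀ : ℝ, 0 < θ₀ ∧ ∀ θ : ℝ, 0 ≤ θ → θ ≤ θ₀ → X θ * θ ≤ 1 / 4 :=
    exists_threshold (F := fun θ => X θ * θ) (by fun_prop) (by norm_num)
  have t7 : ∃ θ₀ : ℝ, 0 < θ₀ ∧ ∀ θ : ℝ, 0 ≤ θ → θ ≤ θ₀ → T θ * θ ≤ 1 / 4 :=
    exists_threshold (F := fun θ => T θ * θ) (by fun_prop) (by norm_num)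
  have t8 : ∃ θ₀ : ℝ, 0 < θ₀ ∧ ∀ θ : ℝ, 0 ≤ θ → θ ≤ θ₀ → 300 * D * ((2 * R θ + 8 * X θ * Y θ * θ + cη) * θ) ≤ 1 :=
    exists_threshold (F := fun θ => 300 * D * ((2 * R θ + 8 * X θ * Y θ * θ + cη) * θ)) (by fun_prop) (by norm_num)
  have t9 : ∃ θ₀ : ℝ, 0 < θ₀ ∧ ∀ θ : ℝ, 0 ≤ θ → θ ≤ θ₀ → θ * (18 * ((128 * K₁ + 4 * K₂ * C₂) * C' ^ 2 * L ^ 2) + 72 * X θ * Y θ) ≤ 1 :=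
    exists_threshold (F := fun θ => θ * (18 * ((128 * K₁ + 4 * K₂ * C₂) * C' ^ 2 * L ^ 2) + 72 * X θ * Y θ)) (by fun_prop) (by norm_num)
  obtain ⟨θ₀, hθ₀, H⟩ := threshold_and t1 (threshold_and t2 (threshold_and t3 (threshold_and t4 (threshold_and t5
    (threshold_and t6 (threshold_and t7 (threshold_and t8 t9)))))))
  refine ⟨θ₀, hθ₀, fun θ hθ0 hθ1 => ?_⟩
  obtain ⟨h1, h2, h3, h4, h5, h6, h7, h8, h9⟩ := H θ hθ0 hθ1
  refine ⟨h1, h2, h3, ?_⟩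
  intro Λ M b h hΛ hΛM hb0 hb hh0 hh a ρ t ha hρ ht
  have hΛ0 : 0 < Λ := by linarith
  have hM0 : 0 < M := by linarith
  have hΛne : Λ ≠ 0 := hΛ0.ne'
  have hRθ := hR0 θ hθ0
  have hXθ := hX0 θ hθ0
  have hTθ := hT0 θ hθ0
  have hYθ := hY0 θ hθ0
  -- exact identities
  have hΛs : Λ * (2 * a) = 2 * C' * L * θ := by rw [ha, hC']; field_simp
  have ha' : a = C' * L * θ / Λ := by rw [ha, hC']
  have ha0 : 0 ≤ a := by
    have : 0 ≤ C' * L * θ / Λ := by positivity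
    linarith
  -- (1) `a ≤ 1/128`
  have c1 : a ≤ 1 / 128 := by
    calc a = C' * L * θ / Λ := ha'
      _ ≤ C' * L * θ := div_le_self (by positivity) hΛ
      _ ≤ 1 / 128 := h4
  -- (2) the σ-line
  have c2 : 4 * (3 + 12 * D) ^ 2 * Λ * (2 * a) ≤ r ^ 2 := by
    calc 4 * (3 + 12 * D) ^ 2 * Λ * (2 * a) = 4 * (3 + 12 * D) ^ 2 * (Λ * (2 * a)) := by ring
      _ = 8 * (3 + 12 * D) ^ 2 * C' * L * θ := by rw [hΛs]; ring
      _ ≤ r ^ 2 := h5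
  -- `Λ·ε ≤ θ∕Λ`, `Λ²·ε ≤ θ`
  have hΛM2 : Λ * Λ ≤ M ^ 2 := by
    rw [sq]; exact mul_le_mul hΛM hΛM hΛ0.le hM0.le
  have hΛe : Λ * (θ / M ^ 2) ≤ θ / Λ := by
    rw [mul_div_assoc', div_le_div_iff₀ (by positivity) hΛ0]
    calc Λ * θ * Λ = θ * (Λ * Λ) := by ring
      _ ≤ θ * M ^ 2 := mul_le_mul_of_nonneg_left hΛM2 hθ0
  have hΛ2e : Λ ^ 2 * (θ / M ^ 2) ≤ θ := by
    have h := mul_le_mul_of_nonneg_left hΛe hΛ0.le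
    calc Λ ^ 2 * (θ / M ^ 2) = Λ * (Λ * (θ / M ^ 2)) := by ring
      _ ≤ Λ * (θ / Λ) := h
      _ = θ := by field_simp
  -- (3) `ρ ≤ R θ · θ∕Λ`
  have hρR : ρ ≤ R θ * θ / Λ := by
    have e1 : K₁ * Λ * (θ / M ^ 2 + 32 * (2 * a) ^ 2) = K₁ * (Λ * (θ / M ^ 2)) + 32 * K₁ * (Λ * (2 * a)) * (2 * a) := by ring
    have e2 : K₂ * (2 * b + C₂ * (Λ * (2 * a)) ^ 2) / Λ = (2 * K₂ * b + K₂ * C₂ * (Λ * (2 * a)) ^ 2) / Λ := by ring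
    rw [hρ, e1, e2, hΛs, ha']
    have hb' : (2 * K₂ * b + K₂ * C₂ * (2 * C' * L * θ) ^ 2) / Λ ≤ (2 * K₂ * (cb * θ) + K₂ * C₂ * (2 * C' * L * θ) ^ 2) / Λ := by
      gcongr
    have hK : K₁ * (Λ * (θ / M ^ 2)) ≤ K₁ * (θ / Λ) := mul_le_mul_of_nonneg_left hΛe hK₁
    have hid : K₁ * (θ / Λ) + 32 * K₁ * (2 * C' * L * θ) * (2 * (C' * L * θ / Λ))
        + (2 * K₂ * (cb * θ) + K₂ * C₂ * (2 * C' * L * θ) ^ 2) / Λ = R θ * θ / Λ := by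
      simp only [hRdef]; field_simp; ring
    linarith
  -- (4) `t ≤ T θ · θ`
  have htT : t ≤ T θ * θ := by
    have e1 : Λ ^ 2 * (θ / M ^ 2 + 32 * (2 * a) ^ 2) = Λ ^ 2 * (θ / M ^ 2) + 32 * (Λ * (2 * a)) ^ 2 := by ring
    rw [ht, e1, hΛs]
    have hid : K₃ * (2 * C' * L * θ + (2 * (cb * θ) + C₂ * (2 * C' * L * θ) ^ 2) + (θ + 32 * (2 * C' * L * θ) ^ 2)) = T θ * θ := by
      simp only [hTdef]; ring
    have hmono : K₃ * (2 * C' * L * θ + (2 * b + C₂ * (2 * C' * L * θ) ^ 2) + (Λ ^ 2 * (θ / M ^ 2) + 32 * (2 * C' * L * θ) ^ 2))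
        ≤ K₃ * (2 * C' * L * θ + (2 * (cb * θ) + C₂ * (2 * C' * L * θ) ^ 2) + (θ + 32 * (2 * C' * L * θ) ^ 2)) := by
      gcongr
    linarith
  -- (5) `ρ + 2a ≤ X θ · θ∕Λ ≤ X θ · θ`
  have hρa : ρ + 2 * a ≤ X θ * θ / Λ := by
    have hid : X θ * θ / Λ = R θ * θ / Λ + 2 * (C' * L * θ / Λ) := by simp only [hXdef]; ring
    rw [hid, ← ha']; linarith
  have hXθΛ : X θ * θ / Λ ≤ X θ * θ := div_le_self (by positivity) hΛ
  have c3 : ρ + 2 * a ≤ 1 / 4 := (hρa.trans hXθΛ).trans h6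
  have c4 : t ≤ 1 / 4 := htT.trans h7
  have hρ0' : 0 ≤ ρ := by
    have h0 : 0 ≤ K₁ * Λ * (θ / M ^ 2 + 32 * (2 * a) ^ 2) + K₂ * (2 * b + C₂ * (Λ * (2 * a)) ^ 2) / Λ := by positivity
    exact hρ ▸ h0
  have hρ0 : 0 ≤ ρ + 2 * a := add_nonneg hρ0' (by positivity)
  have ht0 : 0 ≤ t := by
    have h0 : 0 ≤ K₃ * (Λ * (2 * a) + (2 * b + C₂ * (Λ * (2 * a)) ^ 2) + Λ ^ 2 * (θ / M ^ 2 + 32 * (2 * a) ^ 2)) := by positivity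
    exact ht ▸ h0
  -- (6) `ρ₁ ≤ (2R + 8XYθ)θ∕Λ`
  have hρ₁ : 2 * ρ + 8 * (t + (ρ + 2 * a)) * (ρ + 2 * a) ≤ (2 * R θ + 8 * X θ * Y θ * θ) * θ / Λ := by
    have hY : t + (ρ + 2 * a) ≤ Y θ * θ := by
      have : Y θ * θ = T θ * θ + X θ * θ := by simp only [hYdef]; ring
      rw [this]; linarith
    have hprod : (t + (ρ + 2 * a)) * (ρ + 2 * a) ≤ (Y θ * θ) * (X θ * θ / Λ) :=
      mul_le_mul hY hρa hρ0 (by positivity)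
    have hid : (2 * R θ + 8 * X θ * Y θ * θ) * θ / Λ = 2 * (R θ * θ / Λ) + 8 * ((Y θ * θ) * (X θ * θ / Λ)) := by ring
    rw [hid]; linarith
  -- (7) the `ω`-line
  have c5 : 300 * D * (Λ * (2 * ρ + 8 * (t + (ρ + 2 * a)) * (ρ + 2 * a)) + h) ≤ 1 := by
    have hΛρ₁ : Λ * (2 * ρ + 8 * (t + (ρ + 2 * a)) * (ρ + 2 * a)) ≤ (2 * R θ + 8 * X θ * Y θ * θ) * θ := by
      have h := mul_le_mul_of_nonneg_left hρ₁ hΛ0.le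
      rwa [mul_div_cancel₀ _ hΛne] at h
    have hsum : Λ * (2 * ρ + 8 * (t + (ρ + 2 * a)) * (ρ + 2 * a)) + h ≤ (2 * R θ + 8 * X θ * Y θ * θ + cη) * θ := by linarith
    calc 300 * D * (Λ * (2 * ρ + 8 * (t + (ρ + 2 * a)) * (ρ + 2 * a)) + h) ≤ 300 * D * ((2 * R θ + 8 * X θ * Y θ * θ + cη) * θ) :=
          mul_le_mul_of_nonneg_left hsum (by positivity)
      _ ≤ 1 := h8
  -- (8) the output
  have c6 : 9 * (2 * ρ + 8 * (t + (ρ + 2 * a)) * (ρ + 2 * a)) + 8 * h / Λ ≤ C' * θ / Λ := by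
    have hh' : 8 * h / Λ ≤ 8 * (cη * θ) / Λ := by gcongr
    have hmain : 9 * ((2 * R θ + 8 * X θ * Y θ * θ) * θ / Λ) + 8 * (cη * θ) / Λ ≤ C' * θ / Λ := by
      rw [show 9 * ((2 * R θ + 8 * X θ * Y θ * θ) * θ / Λ) + 8 * (cη * θ) / Λ = (18 * R θ + 72 * X θ * Y θ * θ + 8 * cη) * θ / Λ by
        ring]
      refine div_le_div_of_nonneg_right (mul_le_mul_of_nonneg_right ?_ hθ0) hΛ0.le
      have hid : 18 * R θ + 72 * X θ * Y θ * θ + 8 * cη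
          = 18 * K₁ + 36 * K₂ * cb + 8 * cη + θ * (18 * ((128 * K₁ + 4 * K₂ * C₂) * C' ^ 2 * L ^ 2) + 72 * X θ * Y θ) := by
        simp only [hRdef]; ring
      rw [hid, hC']
      linarith
    linarith
  exact ⟨c1, c2, c3, c4, c5, c6⟩

end Summit.QuantumFields.BalabanUV.T4Continuum.NE7SliceInductionRates
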